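import Summits.MatrixMultiplication.MatrixMultiplication.Theorems.TetrahedronTensorKronecker
import Literature.Computability.AlgebraicComplexity.SmallFormatRank
import HarnessLib

/-!
# Tetrahedron tensor — the first kernel rung of the level ladder: `R₄(T(K₄)_4) ≤ 2401`, `ω(K₄) ≤ 17/3`

The finite-certificate instrument of the crux `TetraFlat` (route `TetrahedronCarving`, decomp-mm lens 6,
g13) run end-to-end in the kernel on its cheapest input: Strassen's `R(⟨2,2,2⟩) ≤ 7`
(`tensorRank_matMulTensor_two_le_seven`) and the four-triangle cover of the doubled tetrahedron at
level `2·2` (`tensorRankD_tetra_sq_le`) give the LEVEL-4 CERTIFICATE `R₄(T(K₄)_4) ≤ 7⁴ = 2401 < 4⁶`,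
and one certificate bounds the exponent (`omegaTetra_le_of_level`): since `2401³ ≤ 4¹⁷`,
**`ω(K₄) ≤ 17/3` over every field** (any characteristic). The printed ladder continues
`6 → 17/3 (here) → 4.63766` (CVZ19 Cor. 1.2.6) `→ 4.633908` (BCKLOSW26 Thm. 48) `→ 4` (= `TetraFlat`).
Sorry-free.
-/

noncomputable section

set_option linter.dupNamespace false

namespace Summit.MatrixMultiplication.MatrixMultiplication.Theorems.TetrahedronTensor

open Literature.Computability.AlgebraicComplexity

variable (F : Type) [Field F]

/-- **Level-4 certificate**: `R₄(T(K₄)_4) ≤ 2401` (Strassen's seven products, to the fourth power,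
through the cover `R₄(T(K₄)_{2·2}) ≤ R(⟨2,2,2⟩)⁴`). [cite: Strassen1969] -/
theorem tensorRankD_tetra_four_le : tensorRankD (tetra F 4) ≤ 2401 := by
  have h := tensorRankD_tetra_sq_le (F := F) 2
  have h7 := tensorRank_matMulTensor_two_le_seven F
  calc tensorRankD (tetra F 4) = tensorRankD (tetra F (2 * 2)) := rfl
    _ ≤ tensorRank (matMulTensor F 2 2 2) ^ 4 := h
    _ ≤ 7 ^ 4 := Nat.pow_le_pow_left h7 4
    _ = 2401 := by norm_num

/-- The numerical inequality behind the exponent: `2401 ≤ 4^{17/3}` (i.e. `2401³ ≤ 4¹⁷`). [folklore] -/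
theorem cert_level_four : (2401 : ℝ) ≤ ((4 : ℕ) : ℝ) ^ ((17 : ℝ) / 3) := by
  have h4 : (0 : ℝ) ≤ ((4 : ℕ) : ℝ) ^ ((17 : ℝ) / 3) := by positivity
  rw [← pow_le_pow_iff_left₀ (by norm_num) h4 (by norm_num : (3 : ℕ) ≠ 0)]
  rw [← Real.rpow_natCast (((4 : ℕ) : ℝ) ^ ((17 : ℝ) / 3)) 3,
    ← Real.rpow_mul (by norm_num : (0 : ℝ) ≤ ((4 : ℕ) : ℝ))]
  have e : (17 : ℝ) / 3 * ((3 : ℕ) : ℝ) = ((17 : ℕ) : ℝ) := by norm_num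
  rw [e, Real.rpow_natCast]
  norm_num

/-- **First kernel rung of the ladder: `ω(K₄) ≤ 17/3` over every field**, from the single level-4
certificate. [cite: Strassen1969] -/
theorem omegaTetra_le_seventeen_thirds : omegaTetra F ≤ 17 / 3 := by
  refine omegaTetra_le_of_level F (N := 4) (θ := 17 / 3) (by norm_num) (by norm_num) ?_
  have h : (tensorRankD (tetra F 4) : ℝ) ≤ 2401 := by
    exact_mod_cast tensorRankD_tetra_four_le F
  exact h.trans (cert_level_four)

/-- The kernel bracket after the first rung: `4 ≤ ω(K₄) ≤ 17/3`. [folklore] -/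
theorem omegaTetra_mem_Icc_four_seventeen_thirds :
    4 ≤ omegaTetra F ∧ omegaTetra F ≤ 17 / 3 :=
  ⟨four_le_omegaTetra F, omegaTetra_le_seventeen_thirds F⟩

end Summit.MatrixMultiplication.MatrixMultiplication.Theorems.TetrahedronTensor

end
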